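import Mathlib
import HarnessLib
import Literature.MathematicalPhysics.StatisticalMechanics.AbkmPackageSlotF4Phi22
import Literature.MathematicalPhysics.StatisticalMechanics.StepOperatorBParaSecondDiffTorusFRD

/-!
# The slot `F4b2` of `AbkmPackageSlots` HOLDS with an `N`-free size: the `ℓ = 2` `B_k` half of
# `L2GaussianCore` ([ABKM19] Lemma 12.6 (12.52) with `ℓ = 2`; Lemma 8.7 ⊗ Lemma 8.4)

`AbkmPackageSlots.F4b2 P Q bTT` asks, for the package `P` at height `N` (`Q`), for mixed second differences
of `q ↦ B_k^{(q)} v` (`Q.opB q k = rgBT`) on parallelograms in the tuning ball, all steps `k + 1 ≤ N`: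
`‖B_{q+y+z}v − B_{q+y}v − B_{q+z}v + B_qv‖_{k+1,0} ≤ b_TT |y|₁ |z|₁ c_v`.  This file DISCHARGES it from
`hamNorm_opB_paraSecondDiff_unif_of_torusFRD` (opB of the step data of the kernel families) through the
identification `rgBT = rgBQ = ofHam ∘ opB ∘ abkmStepData` on the ball (`rgBT_of_mem`, `opBHomQ_apply`):

* `packageAt_opB_apply_of_mem` — `Q.opB q k v = ofHam (opB (abkmStepData L R k 𝒞s_q) v)` on the ball;
* **`f4b2_of_packageAt`** — `F4b2 P Q (size)` with the explicit `N`-free size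
  `4 L^d C_{8.7} (r₀+1) A⁻¹ d⁴ (108 q_H² S² e^{4K} K² (4^dκ) + 8 q_H S max(K⁽²⁾,0) (2^dκ))`;
* **`exists_f4b2_unif`** — the `F4b2` half of `L2GaussianCore`; **`l2GaussianCore`** — `L2GaussianCore d`
  (both halves, with `exists_f4Φ22_unif`).

Everything is proved; no named fact is assumed.  Honest scope: `q`-regularity slots of the rung route
(complex Gaussian gradient-field stiffness, [ABKM19] RG); nothing about superconductivity in the Hubbard model.

## References
* S. Adams, S. Buchholz, R. Kotecký, S. Müller, arXiv:1910.13564, Lemma 8.7, Lemma 12.6 (12.52), Lemma 8.4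
  [AdamsBuchholzKoteckyMuller2019].
* S. Buchholz, J. Funct. Anal. 275 (2018), Thm 4.5 [Buchholz2016].
-/

noncomputable section

namespace Literature.MathematicalPhysics.StatisticalMechanics.GradientRG

open scoped BigOperators
open Real Finset MeasureTheory
open Literature.MathematicalPhysics.StatisticalMechanics.GradientFRD
  (fourierCoeff IsElliptic IsUnitSymm InShell iterDiff supNorm conv ellOp isElliptic_one)
open Literature.MathematicalPhysics.StatisticalMechanics.TorusPolymer (IsPolymer numBlocks)
open Literature.Barriers.CriticalPhenomena.LongRangePhi4.Polymer (IsConn)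
open Literature.MathematicalPhysics.QuantumFieldTheory

variable {d : ℕ}

/-- **On the ball, `B_k^{(q)} v = ofHam (opB (abkmStepData L R k 𝒞s_q) v)`** (`k + 1 ≤ N`): the total
operator `rgBT` is `rgBQ` of the family `𝒞s_q`, which at an admissible step is `ofHam ∘ opBHomQ`.
[cite: AdamsBuchholzKoteckyMuller2019, Thm 6.8 (the operator B_k)] -/
theorem packageAt_opB_apply_of_mem (P : PackageData d) [Fact (0 < P.h)] [Fact (0 < P.L)] {N M : ℕ}
    [NeZero M] (Q : PackageAt P N M) {q : Matrix (Fin d) (Fin d) ℝ} (hq : P.InBall q) {k : ℕ}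
    (hk : k + 1 ≤ N) (v : activitySpace Q.normParams k) :
    Q.opB q k v = HamSpace.ofHam (opB (abkmStepData P.L P.R k (Q.kernels q))
      (v : Finset (Fin d → ZMod M) → ((Fin d → ZMod M) → ℝ) → ℂ)) := by
  unfold PackageAt.opB
  rw [rgBT_of_mem P.hd P.hMord P.hMR P.hLodd P.hL Q.hM P.hθbar P.hlam P.hn P.hn2 P.hnñ P.hc P.hC1 Q.hallA
    Q.hB P.pT P.r₀ P.hr₀ P.A P.hθ0 P.hθ P.hT₀ P.hKT₀ hq.1 hq.2]
  unfold rgBQ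
  rw [dif_pos hk]
  simp only [AddMonoidHom.coe_comp, Function.comp_apply, LinearMap.toAddMonoidHom_coe, LinearEquiv.coe_coe,
    opBHomQ_apply]

/-- **The slot `F4b2` holds with an explicit `N`-free size** at every height.
[cite: AdamsBuchholzKoteckyMuller2019, Lemma 8.7 / Lemma 12.6 (12.52), ℓ = 2] -/
theorem f4b2_of_packageAt (P : PackageData d) [Fact (0 < P.h)] [Fact (0 < P.L)] {N M : ℕ} [NeZero M]
    (Q : PackageAt P N M) :
    F4b2 P Q
      (4 * ((P.L : ℝ) ^ d * pi2BoundConst d (((2 * P.R + 2 : ℕ) : ℝ) + ((d / 2 + 1 : ℕ) : ℝ)) *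
        ((P.r₀ + 1) * P.A⁻¹ * (d : ℝ) ^ 4 *
          (108 * Real.conjExponent ((1 + (P.θ + P.θbar) / 2) / (1 + P.θ)) ^ 2 * Real.sqrt ((3 : ℝ) ^ (d + 1) * (((2 * ((2 * (2 ^ d + P.R) + 2 * P.pT + 1) + 1) : ℕ) : ℝ)) ^ d) ^ 2 *
              Real.exp (4 * shellRatioConst P.c (P.Cℓ 1) (P.L : ℝ) d P.ñ) *
              shellRatioConst P.c (P.Cℓ 1) (P.L : ℝ) d P.ñ ^ 2 *
              (((2 : ℝ) ^ d) ^ 2 * weightIntConstRho P.θbar ((P.θ + P.θbar) / 2)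
            (traceConst d P.Mord P.R P.lam (derivSum d P.n fun θ' _ => P.Cα θ' 0)) ^ (1 / ((1 + (P.θ + P.θbar) / 2) / (1 + P.θ)))) +
            8 * Real.conjExponent ((1 + (P.θ + P.θbar) / 2) / (1 + P.θ)) * Real.sqrt ((3 : ℝ) ^ (d + 1) * (((2 * ((2 * (2 ^ d + P.R) + 2 * P.pT + 1) + 1) : ℕ) : ℝ)) ^ d) * max (shellRatioConst P.c (P.Cℓ 2) (P.L : ℝ) d P.ñ) 0 *
              ((2 : ℝ) ^ d * weightIntConstRho P.θbar ((P.θ + P.θbar) / 2)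
            (traceConst d P.Mord P.R P.lam (derivSum d P.n fun θ' _ => P.Cα θ' 0)) ^ (1 / ((1 + (P.θ + P.θbar) / 2) / (1 + P.θ)))))))) := by
  intro q y z hq hqy hqz hqyz k hk v cv hv
  set pH := ((1 + (P.θ + P.θbar) / 2) / (1 + P.θ)) with hpH
  -- Hölder data (N-free)
  set ρ'' := (P.θ + P.θbar) / 2 with hρ''def
  have hρ''0 : 0 ≤ ρ'' := by rw [hρ''def]; linarith [P.hθ0, P.hθ, P.hθbar]
  have hρ''θ : ρ'' < P.θbar := by rw [hρ''def]; linarith [P.hθ]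
  have h1θ : 0 < 1 + P.θ := by linarith [P.hθ0]
  have hp1 : 1 < pH := by
    rw [hpH, one_lt_div h1θ]; linarith [P.hθ]
  have hpq : pH.HolderConjugate (Real.conjExponent pH) := Real.HolderConjugate.conjExponent hp1
  have hpρ : pH * (1 + P.θ) ≤ 1 + ρ'' := by
    rw [hpH, hρ''def, div_mul_cancel₀ _ h1θ.ne']
  have hA : 0 < P.A := by linarith [P.hA1]
  have hC2 : 0 ≤ P.Cℓ 2 := cl_nonneg_of_packageAt P Q (by norm_num)
  -- data of `v`
  have hvW : WeakNormLE Q.normParams k (v : Finset (Fin d → ZMod M) → ((Fin d → ZMod M) → ℝ) → ℂ) cv := hv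
  have hvd : ∀ X, ContDiff ℝ P.r₀ ((v : Finset (Fin d → ZMod M) → ((Fin d → ZMod M) → ℝ) → ℂ) X) :=
    activitySpace.contDiff v
  have hvloc : ∀ X, IsPolymer (P.L ^ k) X → IsConn X →
      IsGaugeLocal (Q.normParams.gauge k X) ((v : Finset (Fin d → ZMod M) → ((Fin d → ZMod M) → ℝ) → ℂ) X) :=
    fun X hX hXc => activitySpace.isGaugeLocal v hX hXc
  have hMt : M = Q.normParams.L ^ k * P.L ^ (N - k) := by
    show M = P.L ^ k * P.L ^ (N - k)
    rw [Q.hM, ← pow_add, Nat.add_sub_cancel' (by omega)]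
  have hcv : 0 ≤ cv := nonneg_of_weakNormLE hA hMt P.hLodd.pow P.hLodd.pow hvW
  have hmain := hamNorm_opB_paraSecondDiff_unif_of_torusFRD P.hd P.hMord P.hMR P.hLodd P.hL Q.hM P.hθbar P.hlam
    P.hn P.hn2 P.hnñ P.hgap P.hc P.hC1 hC2 Q.hallA Q.hB hk P.hpM P.hr₀ P.hh P.hA1 P.hθ0 P.hθ P.hT₀ P.hKT₀ hq hqy
    hqz hqyz hpq hρ''0 hρ''θ hpρ hcv hvW hvd hvloc
  -- identify the four `B`'s
  rw [packageAt_opB_apply_of_mem P Q hqyz hk, packageAt_opB_apply_of_mem P Q hqy hk,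
    packageAt_opB_apply_of_mem P Q hqz hk, packageAt_opB_apply_of_mem P Q hq hk, ← map_sub, ← map_sub, ← map_add,
    HamSpace.norm_def, HamSpace.toHam_ofHam]
  refine hmain.trans ?_
  have hA𝒫p : 0 ≤ weightIntConstRho P.θbar ρ''
      (traceConst d P.Mord P.R P.lam (derivSum d P.n fun θ' _ => P.Cα θ' 0)) :=
    zero_le_one.trans (one_le_weightIntConstRho P.hθbar hρ''0 hρ''θ
      (traceConst_nonneg d P.Mord P.R P.hlam.le (derivSum_nonneg d P.n _)))
  have hκ : 0 ≤ weightIntConstRho P.θbar ρ''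
      (traceConst d P.Mord P.R P.lam (derivSum d P.n fun θ' _ => P.Cα θ' 0)) ^ (1 / pH) :=
    Real.rpow_nonneg hA𝒫p _
  have hq0 : 0 ≤ Real.conjExponent pH := by linarith [hpq.symm.lt]
  have hK1 : 0 ≤ shellRatioConst P.c (P.Cℓ 1) (P.L : ℝ) d P.ñ :=
    shellRatioConst_nonneg P.hc P.hC1 (Nat.cast_nonneg _) d P.ñ
  have hAinv : 0 ≤ P.A⁻¹ := inv_nonneg.2 hA.le
  have hmax : shellRatioConst P.c (P.Cℓ 2) (P.L : ℝ) d P.ñ ≤ max (shellRatioConst P.c (P.Cℓ 2) (P.L : ℝ) d P.ñ) 0 :=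
    le_max_left _ _
  have hC87 : 0 ≤ pi2BoundConst d (((2 * P.R + 2 : ℕ) : ℝ) + ((d / 2 + 1 : ℕ) : ℝ)) :=
    pi2BoundConst_nonneg d (by positivity)
  have hS0 : 0 ≤ Real.sqrt ((3 : ℝ) ^ (d + 1) * (((2 * ((2 * (2 ^ d + P.R) + 2 * P.pT + 1) + 1) : ℕ) : ℝ)) ^ d) := Real.sqrt_nonneg _
  have hy0 : 0 ≤ ∑ i, ∑ j, |y i j| := entrySum_nonneg y
  have hz0 : 0 ≤ ∑ i, ∑ j, |z i j| := entrySum_nonneg z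
  unfold esum
  gcongr

/-- **The `F4b2` half of `L2GaussianCore`**: every package admits an `N`-free size for the slot F4b2.
[cite: AdamsBuchholzKoteckyMuller2019, Lemma 12.6 (12.52), ℓ = 2] -/
theorem exists_f4b2_unif (P : PackageData d) [Fact (0 < P.h)] [Fact (0 < P.L)] :
    ∃ bTT : ℝ, 0 ≤ bTT ∧ ∀ (N M : ℕ) [NeZero M] (Q : PackageAt P N M), F4b2 P Q bTT := by
  refine ⟨(4 * ((P.L : ℝ) ^ d * pi2BoundConst d (((2 * P.R + 2 : ℕ) : ℝ) + ((d / 2 + 1 : ℕ) : ℝ)) *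
        ((P.r₀ + 1) * P.A⁻¹ * (d : ℝ) ^ 4 *
          (108 * Real.conjExponent ((1 + (P.θ + P.θbar) / 2) / (1 + P.θ)) ^ 2 * Real.sqrt ((3 : ℝ) ^ (d + 1) * (((2 * ((2 * (2 ^ d + P.R) + 2 * P.pT + 1) + 1) : ℕ) : ℝ)) ^ d) ^ 2 *
              Real.exp (4 * shellRatioConst P.c (P.Cℓ 1) (P.L : ℝ) d P.ñ) *
              shellRatioConst P.c (P.Cℓ 1) (P.L : ℝ) d P.ñ ^ 2 *
              (((2 : ℝ) ^ d) ^ 2 * weightIntConstRho P.θbar ((P.θ + P.θbar) / 2)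
            (traceConst d P.Mord P.R P.lam (derivSum d P.n fun θ' _ => P.Cα θ' 0)) ^ (1 / ((1 + (P.θ + P.θbar) / 2) / (1 + P.θ)))) +
            8 * Real.conjExponent ((1 + (P.θ + P.θbar) / 2) / (1 + P.θ)) * Real.sqrt ((3 : ℝ) ^ (d + 1) * (((2 * ((2 * (2 ^ d + P.R) + 2 * P.pT + 1) + 1) : ℕ) : ℝ)) ^ d) * max (shellRatioConst P.c (P.Cℓ 2) (P.L : ℝ) d P.ñ) 0 *
              ((2 : ℝ) ^ d * weightIntConstRho P.θbar ((P.θ + P.θbar) / 2)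
            (traceConst d P.Mord P.R P.lam (derivSum d P.n fun θ' _ => P.Cα θ' 0)) ^ (1 / ((1 + (P.θ + P.θbar) / 2) / (1 + P.θ)))))))), ?_, fun N M _ Q => f4b2_of_packageAt P Q⟩
  set pH := ((1 + (P.θ + P.θbar) / 2) / (1 + P.θ)) with hpH
  have hA : 0 < P.A := by linarith [P.hA1]
  have hρ''0 : 0 ≤ (P.θ + P.θbar) / 2 := by linarith [P.hθ0, P.hθ, P.hθbar]
  have hρ''θ : (P.θ + P.θbar) / 2 < P.θbar := by linarith [P.hθ]
  have hA𝒫p : 0 ≤ weightIntConstRho P.θbar ((P.θ + P.θbar) / 2)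
      (traceConst d P.Mord P.R P.lam (derivSum d P.n fun θ' _ => P.Cα θ' 0)) :=
    zero_le_one.trans (one_le_weightIntConstRho P.hθbar hρ''0 hρ''θ
      (traceConst_nonneg d P.Mord P.R P.hlam.le (derivSum_nonneg d P.n _)))
  have h1θ : 0 < 1 + P.θ := by linarith [P.hθ0]
  have hp1 : 1 < pH := by
    rw [hpH, one_lt_div h1θ]; linarith [P.hθ]
  have hq0 : 0 ≤ Real.conjExponent pH := by
    have := (Real.HolderConjugate.conjExponent hp1).symm.lt; linarith
  have hK1 : 0 ≤ shellRatioConst P.c (P.Cℓ 1) (P.L : ℝ) d P.ñ :=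
    shellRatioConst_nonneg P.hc P.hC1 (Nat.cast_nonneg _) d P.ñ
  have hκ : 0 ≤ weightIntConstRho P.θbar ((P.θ + P.θbar) / 2)
      (traceConst d P.Mord P.R P.lam (derivSum d P.n fun θ' _ => P.Cα θ' 0)) ^ (1 / pH) :=
    Real.rpow_nonneg hA𝒫p _
  have hAinv : 0 ≤ P.A⁻¹ := inv_nonneg.2 hA.le
  have hmax : 0 ≤ max (shellRatioConst P.c (P.Cℓ 2) (P.L : ℝ) d P.ñ) 0 := le_max_right _ _
  have hC87 : 0 ≤ pi2BoundConst d (((2 * P.R + 2 : ℕ) : ℝ) + ((d / 2 + 1 : ℕ) : ℝ)) :=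
    pi2BoundConst_nonneg d (by positivity)
  positivity

/-- **`L2GaussianCore d` holds**: the two `ℓ = 2` slots of [ABKM19] Lemma 12.6 that need only the
second-order Gaussian fluctuation engine — `F4b2` and `F4Φ22` — with `N`-free sizes, for every package.
[cite: AdamsBuchholzKoteckyMuller2019, Lemma 8.4 (ℓ = 2) / Lemma 12.6] -/
theorem l2GaussianCore : L2GaussianCore d := by
  intro P _ _
  obtain ⟨bTT, hb0, hb⟩ := exists_f4b2_unif P
  obtain ⟨φTT, hφ0, hφ⟩ := exists_f4Φ22_unif P
  exact ⟨bTT, φTT, hb0, hφ0, fun N M _ Q => ⟨hb N M Q, hφ N M Q⟩⟩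

end Literature.MathematicalPhysics.StatisticalMechanics.GradientRG

end
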